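import Summits.BirchSwinnertonDyer.BirchSwinnertonDyer.Theorems.ErratumRoadFiveRest3SlackRungs
import HarnessLib

/-!
# Route `ErratumRoadFive` (rung K2), crux `RamNoErratumDataAtFive` (item stmt-BirchSwinnertonDyer-19624): the two PLAN-ONLY
# rung stubs of the registered skeleton v2 (`Cruxes/RamNoErratumDataAtFive`, seat rest-p2 g2, `ledger skeleton check` OK
# 2026-08-27) BY NAME — `stub_rung_rest3_5015b1` and `stub_rung_rest4_5595f1`, registered signatures VERBATIM, each a
# one-line application of the landed slack-road certificate theorem (`Theorems/ErratumRoadFiveRest3SlackRungs.lean`,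
# p475167 ∕ p475571) — cell `bsd-stepL`, seat `bsd-stepL-rest-p2` g2; `--supports stmt-BirchSwinnertonDyer-19624`

HONEST FRAMING: THEOREMS ONLY (no definition, no named fact, no `sorry`); CONDITIONAL on every displayed binder — the route's
published support items `PublishedInputsFive` (19066) and `JSWAnticyclotomicControlMult` (19626) and ONE attested Heegner
datum per pair (existential binders; a finite computation, NOT kernel-checked: seat g0 kit j255090, seat g2 kit j261919);
ONE curve per theorem; nothing is booked; BSD is proved for no pair; no census word moves (T7). The rungs are T3 evidence
of the route (BC5), not progress on the regime stubs `stub_rest3_locus` ∕ `stub_rest3_tam`, which stay OPEN.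

* `Rest3Rungs.stub_rung_rest3_5015b1` := `rung_5015b1_d179_of_items_of_slackCert` (Locus pair; `K = ℚ(√−179)`,
  `y_K = −2·g`, `ord₅ [E(K):ℤy_K] = 0 = ord₅ ∏ c_ℓ`).
* `Rest3Rungs.stub_rung_rest4_5595f1` := `rung_5595f1_d59_of_items_of_slackCert` (REST⁗ pair; `K = ℚ(√−59)`,
  `y_K = 5·g`, `ord₅ [E(K):ℤy_K] = 1 = ord₅ ∏ c_ℓ`; no `p`-adic regulator, no preprint).

References: [cite: Gross1991, (1.1), Thm. 1.3, (2.2)] [cite: JetchevSkinnerWan2017, Thm. 3.3.1, §7.4.1] [cite: Kolyvagin1990, Thm. A]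
[cite: Cremona1997, Table 1 (curves 5015b1, 5595f1)].
-/

set_option autoImplicit false
-- the Theorems namespace of this sub repeats the summit name by design (D-0017 nested layout)
set_option linter.dupNamespace false

noncomputable section

open scoped Classical

namespace Summit.BirchSwinnertonDyer.BirchSwinnertonDyer.Theorems.Rest3Rungs

/-- **`stub_rung_rest3_5015b1` (crux 19624, registered skeleton v2) BY NAME**: the open input `P2OpenInputOnTreeAt E 5` at
`E = 5015b1` from `PublishedInputsFive` + `JSWAnticyclotomicControlMult` + ONE attested Heegner datum over `ℚ(√−179)`
(`β = 141`, `y_K = −2·(9,0)`, `E(K)_tors = 1`, so `5 ∤ [E(K):ℤy_K]`; seat g0 kit j255090) — `rung_5015b1_d179_of_items_of_slackCert`.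
CONDITIONAL; ONE curve; nothing booked. [cite: Gross1991, (1.1), (2.2)] [cite: JetchevSkinnerWan2017, Thm. 3.3.1]
[cite: Kolyvagin1990, Thm. A] [cite: Cremona1997, Table 1 (curve 5015b1)] -/
theorem stub_rung_rest3_5015b1
    [((⟨0, 0, 1, -248, 1503⟩ : WeierstrassCurve ℤ).baseChange ℚ).IsElliptic] [((⟨0, 0, 1, -248, 1503⟩ : WeierstrassCurve ℤ).baseChange ℚ).IsGloballyMinimal] [NeZero (((⟨0, 0, 1, -248, 1503⟩ : WeierstrassCurve ℤ).baseChange ℚ).conductorNorm ℤ)]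
    (hF : Summit.BirchSwinnertonDyer.BirchSwinnertonDyer.Theses.ErratumRoadFive.PublishedInputsFive)
    (h331 : Summit.BirchSwinnertonDyer.BirchSwinnertonDyer.Theses.ErratumRoadFive.JSWAnticyclotomicControlMult)
    (K : Type) [Field K] [NumberField K] (hK : Literature.NumberTheory.EllipticCurves.IsImaginaryQuadratic K)
    (hdK : NumberField.discr K = -179)
    (hH : Literature.NumberTheory.EllipticCurves.SatisfiesHeegnerHypothesis (((⟨0, 0, 1, -248, 1503⟩ : WeierstrassCurve ℤ).baseChange ℚ).conductorNorm ℤ) K)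
    (Dt : Literature.NumberTheory.EllipticCurves.ModularForms.ModularParametrizationData ((⟨0, 0, 1, -248, 1503⟩ : WeierstrassCurve ℤ).baseChange ℚ) (((⟨0, 0, 1, -248, 1503⟩ : WeierstrassCurve ℤ).baseChange ℚ).conductorNorm ℤ))
    (H : Literature.NumberTheory.EllipticCurves.HeegnerDatum (((⟨0, 0, 1, -248, 1503⟩ : WeierstrassCurve ℤ).baseChange ℚ).conductorNorm ℤ) (NumberField.discr K))
    (ι : K →+* ℂ) (P : (((⟨0, 0, 1, -248, 1503⟩ : WeierstrassCurve ℤ).baseChange ℚ).baseChange K).toAffine.Point)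
    (hP : WeierstrassCurve.Affine.Point.map ι.toRatAlgHom P =
      Literature.NumberTheory.EllipticCurves.ModularForms.heegnerPointComplex Dt H)
    (hc : ¬ (5 : ℤ) ∣ Dt.c) (hnt : ¬ IsOfFinAddOrder P)
    (hidx : padicValNat 5 (AddSubgroup.zmultiples P).index = 0) :
    Summit.BirchSwinnertonDyer.Rank1Residual.X11b.P2OpenInputOnTreeAt
      ((⟨0, 0, 1, -248, 1503⟩ : WeierstrassCurve ℤ).baseChange ℚ) 5 :=
  rung_5015b1_d179_of_items_of_slackCert hF h331 K hK hdK hH Dt H ι P hP hc hnt hidx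

/-- **`stub_rung_rest4_5595f1` (crux 19624, registered skeleton v2) BY NAME**: the open input `P2OpenInputOnTreeAt E 5` at
the REST⁗ pair `E = 5595f1` from `PublishedInputsFive` + `JSWAnticyclotomicControlMult` + ONE attested Tamagawa-slack Heegner
datum over `ℚ(√−59)` (`β = 259`, `y_K = 5·(−5,4)`, `E(K)_tors = 1`, `ord₅ [E(K):ℤy_K] = 1 ≤ 1 = ord₅ c₃`; seat g0 kit j255090,
seat g2 kit j261919) — `rung_5595f1_d59_of_items_of_slackCert`; NO `p`-adic regulator, NO preprint. CONDITIONAL; ONE curve;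
nothing booked. [cite: Gross1991, (1.1), (2.2)] [cite: JetchevSkinnerWan2017, Thm. 3.3.1, §7.4.1] [cite: Kolyvagin1990, Thm. A]
[cite: Cremona1997, Table 1 (curve 5595f1)] -/
theorem stub_rung_rest4_5595f1
    [((⟨1, 0, 0, -71, -234⟩ : WeierstrassCurve ℤ).baseChange ℚ).IsElliptic] [((⟨1, 0, 0, -71, -234⟩ : WeierstrassCurve ℤ).baseChange ℚ).IsGloballyMinimal] [NeZero (((⟨1, 0, 0, -71, -234⟩ : WeierstrassCurve ℤ).baseChange ℚ).conductorNorm ℤ)]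
    (hF : Summit.BirchSwinnertonDyer.BirchSwinnertonDyer.Theses.ErratumRoadFive.PublishedInputsFive)
    (h331 : Summit.BirchSwinnertonDyer.BirchSwinnertonDyer.Theses.ErratumRoadFive.JSWAnticyclotomicControlMult)
    (K : Type) [Field K] [NumberField K] (hK : Literature.NumberTheory.EllipticCurves.IsImaginaryQuadratic K)
    (hdK : NumberField.discr K = -59)
    (hH : Literature.NumberTheory.EllipticCurves.SatisfiesHeegnerHypothesis (((⟨1, 0, 0, -71, -234⟩ : WeierstrassCurve ℤ).baseChange ℚ).conductorNorm ℤ) K)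
    (Dt : Literature.NumberTheory.EllipticCurves.ModularForms.ModularParametrizationData ((⟨1, 0, 0, -71, -234⟩ : WeierstrassCurve ℤ).baseChange ℚ) (((⟨1, 0, 0, -71, -234⟩ : WeierstrassCurve ℤ).baseChange ℚ).conductorNorm ℤ))
    (H : Literature.NumberTheory.EllipticCurves.HeegnerDatum (((⟨1, 0, 0, -71, -234⟩ : WeierstrassCurve ℤ).baseChange ℚ).conductorNorm ℤ) (NumberField.discr K))
    (ι : K →+* ℂ) (P : (((⟨1, 0, 0, -71, -234⟩ : WeierstrassCurve ℤ).baseChange ℚ).baseChange K).toAffine.Point)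
    (hP : WeierstrassCurve.Affine.Point.map ι.toRatAlgHom P =
      Literature.NumberTheory.EllipticCurves.ModularForms.heegnerPointComplex Dt H)
    (hc : ¬ (5 : ℤ) ∣ Dt.c) (hnt : ¬ IsOfFinAddOrder P)
    (hidx : padicValNat 5 (AddSubgroup.zmultiples P).index ≤ 1) :
    Summit.BirchSwinnertonDyer.Rank1Residual.X11b.P2OpenInputOnTreeAt
      ((⟨1, 0, 0, -71, -234⟩ : WeierstrassCurve ℤ).baseChange ℚ) 5 :=
  rung_5595f1_d59_of_items_of_slackCert hF h331 K hK hdK hH Dt H ι P hP hc hnt hidx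

end Summit.BirchSwinnertonDyer.BirchSwinnertonDyer.Theorems.Rest3Rungs

end
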